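import Summits.CriticalPhenomena.PercolationContinuityZ3.Theses.PercHyperscalingGluing
import Summits.CriticalPhenomena.PercolationContinuityZ3.Theorems.PercHyperscalingGluingBoxGluingStubPairFKG
import Summits.CriticalPhenomena.PercolationContinuityZ3.Theorems.PercHyperscalingGluingBoxGluingStubBkSplit
import Summits.CriticalPhenomena.PercolationContinuityZ3.Theorems.PercHyperscalingGluingBoxGluingStubArmPairBK
import Summits.CriticalPhenomena.PercolationContinuityZ3.Theorems.PercHyperscalingGluingBoxGluingOfCritAnnulusNonCrossing
import Literature.Probability.Percolation.TreeGraphBound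

/-!
# `Lines/birth.lean` — skeleton for crux `PercHyperscalingGluing.BoxGluing`, lead reshape r3
(item stmt-CriticalPhenomena-4643 · route route-CriticalPhenomena-PercHyperscalingGluing ·
sub-problem `PercolationContinuityZ3` · birth skeleton by planner-skel-stmt-CriticalPhenomena-4643-0,
2026-08-17; reshapes r1/r2 by lead -0, r3 by lead c1 (prover-line-stmt-CriticalPhenomena-4643-c1-0),
2026-08-17)

**Crux.** `BoxGluing`:
`∃ C > 0, K ≥ 1, ∀ n ≥ 1, π_n² ≤ C · |Λ_n|⁻¹ · Σ_{x ∈ Λ_n} P_{p_c}(0 ↔ x inside Λ_{Kn})`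
for bond percolation on `ℤ³` at `p_c = criticalProbI 3`, `π_n = P_{p_c}(0 ↔ ∂Λ_n)` (`siteToBoundary 3 n`),
`Λ_m = box 3 m`, `τ(0,x) = P(0 ↔ x)`, `τ^{S}(0,x) = P(0 ↔ x inside S)`.  Exponent reading: the open "≤"
half of hyperscaling `2β/ν ≤ d − 2 + η` (`2/ρ ≥ d − 2 + η`), exponent-free, box-averaged, box-restricted.

**Why r3 (lead c1).**  Reshape r2 (lead -0) had open stubs `stub_armPairGluing` and `stub_weakGluing`;
the route's skeptical readers (evidence W.lean, EreadProbe2.lean) and r2's own §4 kernel-certify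
`stub_weakGluing ↔ BoxGluing` and `BoxGluing → stub_armPairGluing`: r2 did not cut the crux.  r3 returns
to the birth seam FULL-SPACE GLUING × BOX RESTRICTION, where NO stub is crux-equivalent by a known
argument, and keeps everything landed in r1/r2 as named helpers:

* `stub_pairFKG` — LANDED (p147250): `|Λ_n| π_n² ≤ Σ_{x∈Λ_n} P(A_0 ∩ A_x)`, `A_y = DCT16.armEvent y n`.
* `stub_armPairGluing` — OPEN, the hyperscaling content (false for `d ≥ 11`, the `d < 6` input enters
  here): `∃ C₁ > 0, ∀ n ≥ 1, Σ_{x∈Λ_n} P(A_0 ∩ A_x) ≤ C₁ Σ_{x∈Λ_n} τ(0,x)`.  With `stub_pairFKG` it is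
  FULL-SPACE GLUING `|Λ_n| π_n² ≤ C₁ Σ_{x∈Λ_n} τ(0,x)` (FS).  Crux-implied (§4, via the landed BK lemma
  `stub_armPairBK`, p149796); NOT known to give the crux back (it lacks localisation).
* `stub_boxRestriction` — OPEN, LOCALISATION of critical connections (BR), dimension-robust (its
  analogue is TRUE in high `d`, Kozma–Nachmias 2011 / Chatterjee–Hanson 2018 restricted two-point
  estimates, where the crux is FALSE): `∃ C₂ > 0, K ≥ 1, ∀ n ≥ 1, Σ_{x∈Λ_n} τ(0,x) ≤ C₂ Σ_{x∈Λ_n} τ^{Λ_{Kn}}(0,x)`.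
  Crux-implied (§4, via the landed BK split `stub_bkSplit`, p147534: `τ ≤ τ^{Λ_{(K+1)n}} + π_{Kn}²`);
  does NOT give the crux back (high `d`).
* `BoxGluing_of : Sig.stub_armPairGluing → Sig.stub_boxRestriction → BoxGluing` — kernel-checked, no
  `sorry`: `|Λ_n| π_n² ≤ Σ_x P(A_0 ∩ A_x) ≤ C₁ Σ_x τ(0,x) ≤ C₁ C₂ Σ_x τ^{Λ_{Kn}}(0,x)`, divide by
  `|Λ_n| = (2n+1)³ > 0`.  Concludes the crux BY NAME.

So `BoxGluing ↔ (FS-arm ∧ BR)` (§4 `boxGluing_iff_openStubs`): the line is an exact cut of the crux into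
its `d`-sensitive half (FS: gluing two `n`-arms rooted within distance `n`, Coniglio / Aizenman 1997 App. A
proliferation exponent `# = 0`; open for `3 ≤ d ≤ 6`, Hutchcroft 2021 p.10, Hutchcroft 2025
arXiv:2510.03951 p.8 "only conditional results [BCKS 1999]") and its `d`-robust half (BR: uniform-in-scale
version of `τ^{Λ_N}(0,x) ↑ τ(0,x)`; only tool in `d = 3`: Cerf 2015 Thm 1.2/1.3, polynomial scale `n^{16…43}`).
The coarse-scale form `stub_weakGluing` of r2 is crux-implied (§4 `coarse_of_boxGluing`) and crux-EQUIVALENT (readers).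

STATE (lead c1, 2026-08-17, cycle 2 of the line): landed p147250 `stub_pairFKG`, p147534 `stub_bkSplit`,
p149796 `stub_armPairBK`, p149070 cone edge `boxGluing_of_critAnnulusNonCrossing` (X_B = stmt-0846 ⟹ crux;
BCKS exponent-free; §4 `openStubs_of_critAnnulusNonCrossing`: the skeleton is CLOSED MODULO stmt-0846),
p172695 `Theorems/PercHyperscalingGluingBoxGluingStructure.lean` (this §4 in tree form: crux ⟹ FS / FS-arm / BR,
crux ↔ FS-arm ∧ BR; and the JUMP-GLUING certificate: the route's deciding theorem consumes only
`∃ C K, ∀ n ≥ 1, θ(p_c)² ≤ C |Λ_n|⁻¹ Σ_{Λ_n} τ^{Λ_{Kn}}`, which is crux-implied, vacuous when `θ(p_c) = 0`,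
implied by stmt-0855 at `p_c`, and sufficient with `FreeBoxShattering`).  BRANCHES: in the jump world
`θ(p_c) > 0`, FS-arm is free (`θ² ≤ τ`) and the crux = BR = jump gluing; in the world `θ(p_c) = 0` the route
needs nothing from the crux, whose content there (FS-arm ∧ BR) is the hyperscaling inequality proper.

Layout: §0 stub statements as name-keyed `Prop`s (`Sig.stub_*`) · §1 the registered stubs (`stub_pairFKG`
landed by reference; `stub_armPairGluing`, `stub_boxRestriction` = `sorry`, the open kernel) · §2 the
composition `BoxGluing_of` · §3 definitional consistency · §4 structure (sorry-free): crux ⟹ each open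
stub, crux ↔ their conjunction, crux ⟹ coarse form, closure modulo X_B.
-/

namespace Summit.CriticalPhenomena.PercolationContinuityZ3.Cruxes.BoxGluing.Birth

open Literature.Probability.Percolation Literature.Probability.LatticeModels
open MeasureTheory

/-! ## §0 The stub statements, name-keyed (what `BoxGluing_of` takes) -/

namespace Sig

/-- Name-keyed statement of `stub_pairFKG` (Harris–FKG pair bound
`|Λ_n| π_n² ≤ Σ_{x∈Λ_n} P(A_0 ∩ A_x)` at `p_c(ℤ³)`). [stub statement; LANDED p147250] -/
def stub_pairFKG : Prop :=
  ∀ n : ℕ,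
    ((box 3 n).card : ℝ) *
        (bondPercolation (zdGraph 3) (criticalProbI 3)).real (siteToBoundary 3 n) ^ 2 ≤
      ∑ x ∈ box 3 n, (bondPercolation (zdGraph 3) (criticalProbI 3)).real
        (DCT16.armEvent 0 n ∩ DCT16.armEvent x n)

/-- Name-keyed statement of `stub_armPairGluing` (arm-pair gluing
`Σ_{x∈Λ_n} P(A_0 ∩ A_x) ≤ C₁ Σ_{x∈Λ_n} τ(0,x)` at `p_c(ℤ³)`). [stub statement; open problem] -/
def stub_armPairGluing : Prop :=
  ∃ C : ℝ, 0 < C ∧ ∀ n : ℕ, 1 ≤ n →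
    ∑ x ∈ box 3 n, (bondPercolation (zdGraph 3) (criticalProbI 3)).real
        (DCT16.armEvent 0 n ∩ DCT16.armEvent x n) ≤
      C * ∑ x ∈ box 3 n, (bondPercolation (zdGraph 3) (criticalProbI 3)).real (openConn 0 x)

/-- Name-keyed statement of `stub_boxRestriction` (localisation
`Σ_{x∈Λ_n} τ(0,x) ≤ C₂ Σ_{x∈Λ_n} τ^{Λ_{Kn}}(0,x)` at `p_c(ℤ³)`). [stub statement; open] -/
def stub_boxRestriction : Prop :=
  ∃ C : ℝ, ∃ K : ℕ, 0 < C ∧ 1 ≤ K ∧ ∀ n : ℕ, 1 ≤ n →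
    ∑ x ∈ box 3 n, (bondPercolation (zdGraph 3) (criticalProbI 3)).real (openConn 0 x) ≤
      C * ∑ x ∈ box 3 n, (bondPercolation (zdGraph 3) (criticalProbI 3)).real
        (openConnIn ↑(box 3 (K * n)) 0 x)

end Sig

/-! ## §1 Registered stubs (`stub_pairFKG` LANDED; the two `sorry`s are the open kernel FS × BR) -/

/-- **Stub 1a — HARRIS–FKG PAIR BOUND** (LANDED, p147250).  For every `n`,
`|Λ_n| · P_{p_c}(0 ↔ ∂Λ_n)² ≤ Σ_{x ∈ Λ_n} P_{p_c}(A_0 ∩ A_x)` on `ℤ³`, `A_y = DCT16.armEvent y n`. -/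
theorem stub_pairFKG :
    ∀ n : ℕ,
      ((box 3 n).card : ℝ) *
          (bondPercolation (zdGraph 3) (criticalProbI 3)).real (siteToBoundary 3 n) ^ 2 ≤
        ∑ x ∈ box 3 n, (bondPercolation (zdGraph 3) (criticalProbI 3)).real
          (DCT16.armEvent 0 n ∩ DCT16.armEvent x n) :=
  Summit.CriticalPhenomena.PercolationContinuityZ3.Theorems.stub_pairFKG

/-- **Stub 1b — ARM-PAIR GLUING (FS-arm; the hyperscaling content `2β/ν ≤ d − 2 + η`, exponent-free and
box-averaged).**  There is `C₁ > 0` such that for every `n ≥ 1`,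
`Σ_{x ∈ Λ_n} P_{p_c}(A_0 ∩ A_x) ≤ C₁ · Σ_{x ∈ Λ_n} P_{p_c}(0 ↔ x)` on `ℤ³`: two `n`-arms rooted at `0`
and at `x ∈ Λ_n` lie in ONE open cluster with conditional probability `≥ 1/C₁`, on average over `x`.
Equivalent (up to `C₁ ↦ C₁ + 1`) to near-miss domination `Σ_x P(A_0 ∩ A_x ∩ {0 ↮ x}) ≤ C Σ_x τ(0,x)`.
Open for `3 ≤ d ≤ 6` (Hutchcroft 2021 p.10; 2025 arXiv:2510.03951 p.8); FALSE for `d ≥ 11`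
(`π_n ≍ n⁻²`, `τ ≍ |x|^{2−d}`); holds in a monolithic jump world with `C₁ = θ*⁻²`. -/
theorem stub_armPairGluing :
    ∃ C : ℝ, 0 < C ∧ ∀ n : ℕ, 1 ≤ n →
      ∑ x ∈ box 3 n, (bondPercolation (zdGraph 3) (criticalProbI 3)).real
          (DCT16.armEvent 0 n ∩ DCT16.armEvent x n) ≤
        C * ∑ x ∈ box 3 n, (bondPercolation (zdGraph 3) (criticalProbI 3)).real (openConn 0 x) := by
  sorry

/-- **Stub 2 — BOX RESTRICTION (BR; localisation of critical connections).**  There are `C₂ > 0` and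
`K ≥ 1` such that for every `n ≥ 1`,
`Σ_{x ∈ Λ_n} P_{p_c}(0 ↔ x) ≤ C₂ · Σ_{x ∈ Λ_n} P_{p_c}(0 ↔ x inside Λ_{Kn})` on `ℤ³`: a bounded fraction of
the expected mass of the cluster of `0` inside `Λ_n` is already carried by connections inside `Λ_{Kn}` —
the UNIFORM-in-scale version of the monotone limit `τ^{Λ_N}(0,x) ↑ τ(0,x)`
(`Literature.Barriers.CriticalPhenomena.tendsto_real_openConnIn_box_tau`).  Dimension-robust: its analogue
holds in high `d` (restricted two-point estimates, Kozma–Nachmias 2011 Lemma 1.1 / Chatterjee–Hanson), where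
the crux fails; crux-implied in `d = 3` (§4); the BK route to it (`stub_bkSplit`) needs
`|Λ_n| π_{Kn}² ≤ ½ Σ_{Λ_n} τ^{Λ_{(K+1)n}}`, which is crux-strength; the only unconditional `d = 3`
localisation is Cerf 2015 Thm 1.3 (box `Λ_{n^{16}}`, and only when `θ > 0`).
WORKER VERDICT (c1 wave 1, p173443 `Theorems/PercHyperscalingGluingBoxGluingStubBoxRestriction.lean`, helper):
`stub-blocked: stmt-CriticalPhenomena-0846` — landed partials: qualitative BR (`K = K(n)`,
`BoxRestriction.exists_scaleFun_sum_openConn_le`), BR from an arm budget (`boxRestriction_of_armBudget`),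
unconditional BR with loss `162 n²` (`sum_openConn_le_sq_mul_sum_openConnIn`), BR ⟹ jump gluing with the same
constants hence BR → FreeBoxShattering → `θ(p_c) = 0` (`percolationContinuityZ3_of_boxRestriction`: BR alone
replaces the crux in the route's assembly), BR false in a shattered jump world (`not_boxRestriction_of_theta_pos`),
averaged X_D at `p_c` ⟹ BR (`boxRestriction_of_linearScaleLRO`). -/
theorem stub_boxRestriction :
    ∃ C : ℝ, ∃ K : ℕ, 0 < C ∧ 1 ≤ K ∧ ∀ n : ℕ, 1 ≤ n →
      ∑ x ∈ box 3 n, (bondPercolation (zdGraph 3) (criticalProbI 3)).real (openConn 0 x) ≤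
        C * ∑ x ∈ box 3 n, (bondPercolation (zdGraph 3) (criticalProbI 3)).real
          (openConnIn ↑(box 3 (K * n)) 0 x) := by
  sorry

/-! ## §2 Composition (kernel-checked, no `sorry`): FS-arm × BR (plus the landed pair bound) give the crux BY NAME -/

theorem BoxGluing_of (h₁ : Sig.stub_armPairGluing) (h₂ : Sig.stub_boxRestriction) :
    Summit.CriticalPhenomena.PercolationContinuityZ3.Theses.PercHyperscalingGluing.BoxGluing := by
  have h₀ : Sig.stub_pairFKG := Summit.CriticalPhenomena.PercolationContinuityZ3.Theorems.stub_pairFKG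
  obtain ⟨C₁, hC₁, h₁⟩ := h₁
  obtain ⟨C₂, K, hC₂, hK, h₂⟩ := h₂
  unfold Summit.CriticalPhenomena.PercolationContinuityZ3.Theses.PercHyperscalingGluing.BoxGluing
  refine ⟨C₁ * C₂, K, mul_pos hC₁ hC₂, hK, ?_⟩
  intro n hn
  set P : Measure (BondConfig (Site 3)) := bondPercolation (zdGraph 3) (criticalProbI 3) with hP
  have hcard : (0 : ℝ) < ((box 3 n).card : ℝ) := by exact_mod_cast (box_nonempty 3 n).card_pos
  have key : ((box 3 n).card : ℝ) * P.real (siteToBoundary 3 n) ^ 2 ≤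
      C₁ * C₂ * ∑ x ∈ box 3 n, P.real (openConnIn ↑(box 3 (K * n)) 0 x) :=
    calc ((box 3 n).card : ℝ) * P.real (siteToBoundary 3 n) ^ 2
        ≤ ∑ x ∈ box 3 n, P.real (DCT16.armEvent 0 n ∩ DCT16.armEvent x n) := h₀ n
      _ ≤ C₁ * ∑ x ∈ box 3 n, P.real (openConn 0 x) := h₁ n hn
      _ ≤ C₁ * (C₂ * ∑ x ∈ box 3 n, P.real (openConnIn ↑(box 3 (K * n)) 0 x)) :=
          mul_le_mul_of_nonneg_left (h₂ n hn) hC₁.le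
      _ = C₁ * C₂ * ∑ x ∈ box 3 n, P.real (openConnIn ↑(box 3 (K * n)) 0 x) := by ring
  have : C₁ * C₂ * ((box 3 n).card : ℝ)⁻¹ * ∑ x ∈ box 3 n, P.real (openConnIn ↑(box 3 (K * n)) 0 x) =
      ((box 3 n).card : ℝ)⁻¹ * (C₁ * C₂ * ∑ x ∈ box 3 n, P.real (openConnIn ↑(box 3 (K * n)) 0 x)) := by
    ring
  rw [this, le_inv_mul_iff₀ hcard]
  exact key

/-! ## §3 Definitional consistency: the registered stubs feed the composition verbatim -/

/-- The registered stub 1a, as spelled out, IS `Sig.stub_pairFKG`. -/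
theorem pairFKG_registered : Sig.stub_pairFKG := stub_pairFKG

/-- The registered stub 1b, as spelled out, IS `Sig.stub_armPairGluing`. -/
theorem armPairGluing_registered : Sig.stub_armPairGluing := stub_armPairGluing

/-- The registered stub 2, as spelled out, IS `Sig.stub_boxRestriction`. -/
theorem boxRestriction_registered : Sig.stub_boxRestriction := stub_boxRestriction

/- The crux from the two open registered stubs (an `example`: no `sorry`-tainted proof of the crux enters
the environment). -/
example : Summit.CriticalPhenomena.PercolationContinuityZ3.Theses.PercHyperscalingGluing.BoxGluing :=
  BoxGluing_of stub_armPairGluing stub_boxRestriction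

/-! ## §4 Structure (sorry-free): each open stub is crux-implied, their conjunction IS the crux, the
coarse-scale form of r2 is crux-equivalent, and the crux is closed modulo X_B (stmt-0846)

* `armPairGluing_of_boxGluing` — `BoxGluing ⟹ FS-arm`: by the landed `Theorems.stub_armPairBK`
  (`P(A_0 ∩ A_x) ≤ π_n² + τ^{Λ_{2n}}(0,x)`) the Harris step is lossless,
  `Σ_x P(A_0 ∩ A_x) ≤ |Λ_n| π_n² + Σ_x τ^{Λ_{2n}}(0,x)`, and the crux bounds `|Λ_n| π_n²`.
* `boxRestriction_of_boxGluing` — `BoxGluing ⟹ BR` (box `Λ_{(K+1)n}`): the landed BK split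
  `Theorems.stub_bkSplit` gives `Σ_x τ ≤ Σ_x τ^{Λ_{(K+1)n}} + |Λ_n| π_{Kn}²`, and
  `|Λ_n| π_{Kn}² ≤ |Λ_n| π_n² ≤ C Σ_x τ^{Λ_{Kn}} ≤ C Σ_x τ^{Λ_{(K+1)n}}`.
* `boxGluing_iff_openStubs` — `BoxGluing ↔ (FS-arm ∧ BR)`.
* `coarse_of_boxGluing` — the r2 stub `stub_weakGluing` (`|Λ_n| π_{Kn}² ≤ C Σ_x τ^{Λ_{(K+1)n}}`) is
  crux-implied (forward direction here) and crux-EQUIVALENT (readers' W.lean / EreadProbe2.lean): why r2 was abandoned.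
* `openStubs_of_critAnnulusNonCrossing` — both open stubs from X_B via the landed cone edge (p149070).
-/

/-- `{0 ↔ x in S}`-sums are dominated by `{0 ↔ x}`-sums. -/
theorem sum_openConnIn_le_sum_openConn (S : Set (Site 3)) (T : Finset (Site 3)) :
    ∑ x ∈ T, (bondPercolation (zdGraph 3) (criticalProbI 3)).real (openConnIn S 0 x) ≤
      ∑ x ∈ T, (bondPercolation (zdGraph 3) (criticalProbI 3)).real (openConn 0 x) :=
  Finset.sum_le_sum fun x _ => measureReal_mono (openConnIn_subset_openConn S 0 x)

/-- In-box sums grow with the box: `Σ_{x∈T} τ^{Λ_a}(0,x) ≤ Σ_{x∈T} τ^{Λ_b}(0,x)` for `a ≤ b`. -/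
theorem sum_openConnIn_box_mono {a b : ℕ} (hab : a ≤ b) (T : Finset (Site 3)) :
    ∑ x ∈ T, (bondPercolation (zdGraph 3) (criticalProbI 3)).real (openConnIn ↑(box 3 a) 0 x) ≤
      ∑ x ∈ T, (bondPercolation (zdGraph 3) (criticalProbI 3)).real (openConnIn ↑(box 3 b) 0 x) :=
  Finset.sum_le_sum fun x _ => measureReal_mono
    (openConnIn_mono (Finset.coe_subset.2 (box_mono 3 hab)) 0 x)

/-- Unpacking the crux at one `n`: `|Λ_n| π_n² ≤ C Σ_{x∈Λ_n} τ^{Λ_{Kn}}(0,x)`. -/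
theorem mul_sq_le_of_boxGluing {C : ℝ} {K n : ℕ}
    (h : (bondPercolation (zdGraph 3) (criticalProbI 3)).real (siteToBoundary 3 n) ^ 2 ≤
      C * ((box 3 n).card : ℝ)⁻¹ * ∑ x ∈ box 3 n,
        (bondPercolation (zdGraph 3) (criticalProbI 3)).real (openConnIn ↑(box 3 (K * n)) 0 x)) :
    ((box 3 n).card : ℝ) * (bondPercolation (zdGraph 3) (criticalProbI 3)).real (siteToBoundary 3 n) ^ 2 ≤
      C * ∑ x ∈ box 3 n,
        (bondPercolation (zdGraph 3) (criticalProbI 3)).real (openConnIn ↑(box 3 (K * n)) 0 x) := by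
  have hcard : (0 : ℝ) < ((box 3 n).card : ℝ) := by exact_mod_cast (box_nonempty 3 n).card_pos
  have h2 := mul_le_mul_of_nonneg_left h hcard.le
  have h3 : ((box 3 n).card : ℝ) * (C * ((box 3 n).card : ℝ)⁻¹ *
        ∑ x ∈ box 3 n, (bondPercolation (zdGraph 3) (criticalProbI 3)).real
          (openConnIn ↑(box 3 (K * n)) 0 x)) =
      C * ∑ x ∈ box 3 n, (bondPercolation (zdGraph 3) (criticalProbI 3)).real
        (openConnIn ↑(box 3 (K * n)) 0 x) := by
    field_simp
  rwa [h3] at h2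

/-- **`BoxGluing ⟹ stub_armPairGluing`** (the FKG step is lossless, by the landed BK lemma `stub_armPairBK`). -/
theorem armPairGluing_of_boxGluing
    (h : Summit.CriticalPhenomena.PercolationContinuityZ3.Theses.PercHyperscalingGluing.BoxGluing) :
    Sig.stub_armPairGluing := by
  obtain ⟨C, K, hC, hK, h⟩ := h
  refine ⟨C + 1, by positivity, fun n hn => ?_⟩
  set P : Measure (BondConfig (Site 3)) := bondPercolation (zdGraph 3) (criticalProbI 3) with hP
  -- BK: Σ_x P(A_0 ∩ A_x) ≤ |Λ_n| π_n² + Σ_x τ^{Λ_{2n}}(0,x)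
  have hBK : ∑ x ∈ box 3 n, P.real (DCT16.armEvent 0 n ∩ DCT16.armEvent x n) ≤
      ((box 3 n).card : ℝ) * P.real (siteToBoundary 3 n) ^ 2 +
        ∑ x ∈ box 3 n, P.real (openConnIn ↑(box 3 (2 * n)) 0 x) := by
    calc ∑ x ∈ box 3 n, P.real (DCT16.armEvent 0 n ∩ DCT16.armEvent x n)
        ≤ ∑ x ∈ box 3 n, (P.real (siteToBoundary 3 n) ^ 2 + P.real (openConnIn ↑(box 3 (2 * n)) 0 x)) :=
          Finset.sum_le_sum fun x hx =>
            Summit.CriticalPhenomena.PercolationContinuityZ3.Theorems.stub_armPairBK n x hx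
      _ = ((box 3 n).card : ℝ) * P.real (siteToBoundary 3 n) ^ 2 +
            ∑ x ∈ box 3 n, P.real (openConnIn ↑(box 3 (2 * n)) 0 x) := by
          rw [Finset.sum_add_distrib, Finset.sum_const, nsmul_eq_mul]
  have hBG := mul_sq_le_of_boxGluing (h n hn)
  have hS1 := sum_openConnIn_le_sum_openConn (↑(box 3 (K * n))) (box 3 n)
  have hS2 := sum_openConnIn_le_sum_openConn (↑(box 3 (2 * n))) (box 3 n)
  calc ∑ x ∈ box 3 n, P.real (DCT16.armEvent 0 n ∩ DCT16.armEvent x n)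
      ≤ C * ∑ x ∈ box 3 n, P.real (openConnIn ↑(box 3 (K * n)) 0 x) +
          ∑ x ∈ box 3 n, P.real (openConnIn ↑(box 3 (2 * n)) 0 x) := hBK.trans (add_le_add_left hBG _)
    _ ≤ C * ∑ x ∈ box 3 n, P.real (openConn 0 x) + ∑ x ∈ box 3 n, P.real (openConn 0 x) :=
        add_le_add (mul_le_mul_of_nonneg_left hS1 hC.le) hS2
    _ = (C + 1) * ∑ x ∈ box 3 n, P.real (openConn 0 x) := by ring

/-- **`BoxGluing ⟹ stub_boxRestriction`** (box `Λ_{(K+1)n}`, constant `C + 1`, by the landed BK split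
`stub_bkSplit` and `π_{Kn} ≤ π_n`). -/
theorem boxRestriction_of_boxGluing
    (h : Summit.CriticalPhenomena.PercolationContinuityZ3.Theses.PercHyperscalingGluing.BoxGluing) :
    Sig.stub_boxRestriction := by
  obtain ⟨C, K, hC, hK, h⟩ := h
  refine ⟨C + 1, K + 1, by positivity, Nat.le_add_left 1 K, fun n hn => ?_⟩
  set P : Measure (BondConfig (Site 3)) := bondPercolation (zdGraph 3) (criticalProbI 3) with hP
  have hcard : (0 : ℝ) ≤ ((box 3 n).card : ℝ) := Nat.cast_nonneg _
  -- BK split summed over x ∈ Λ_n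
  have hsplit : ∑ x ∈ box 3 n, P.real (openConn 0 x) ≤
      ∑ x ∈ box 3 n, P.real (openConnIn ↑(box 3 ((K + 1) * n)) 0 x) +
        ((box 3 n).card : ℝ) * P.real (siteToBoundary 3 (K * n)) ^ 2 := by
    calc ∑ x ∈ box 3 n, P.real (openConn 0 x)
        ≤ ∑ x ∈ box 3 n, (P.real (openConnIn ↑(box 3 ((K + 1) * n)) 0 x) +
            P.real (siteToBoundary 3 (K * n)) ^ 2) :=
          Finset.sum_le_sum fun x hx =>
            Summit.CriticalPhenomena.PercolationContinuityZ3.Theorems.stub_bkSplit K n x hx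
      _ = _ := by rw [Finset.sum_add_distrib, Finset.sum_const, nsmul_eq_mul]
  -- π_{Kn} ≤ π_n and the crux at scale n
  have h1 : P.real (siteToBoundary 3 (K * n)) ≤ P.real (siteToBoundary 3 n) :=
    DCT16.real_siteToBoundary_antitone _ (Nat.le_mul_of_pos_left n hK)
  have hBG := mul_sq_le_of_boxGluing (h n hn)
  have hmono := sum_openConnIn_box_mono (Nat.mul_le_mul_right n (Nat.le_succ K)) (box 3 n)
  calc ∑ x ∈ box 3 n, P.real (openConn 0 x)
      ≤ ∑ x ∈ box 3 n, P.real (openConnIn ↑(box 3 ((K + 1) * n)) 0 x) +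
          ((box 3 n).card : ℝ) * P.real (siteToBoundary 3 n) ^ 2 :=
        hsplit.trans (add_le_add_right
          (mul_le_mul_of_nonneg_left (pow_le_pow_left₀ measureReal_nonneg h1 2) hcard) _)
    _ ≤ ∑ x ∈ box 3 n, P.real (openConnIn ↑(box 3 ((K + 1) * n)) 0 x) +
          C * ∑ x ∈ box 3 n, P.real (openConnIn ↑(box 3 ((K + 1) * n)) 0 x) :=
        add_le_add_right (hBG.trans (mul_le_mul_of_nonneg_left hmono hC.le)) _
    _ = (C + 1) * ∑ x ∈ box 3 n, P.real (openConnIn ↑(box 3 ((K + 1) * n)) 0 x) := by ring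

/-- **The line is an exact cut of the crux.** `BoxGluing ↔ (stub_armPairGluing ∧ stub_boxRestriction)`. -/
theorem boxGluing_iff_openStubs :
    Summit.CriticalPhenomena.PercolationContinuityZ3.Theses.PercHyperscalingGluing.BoxGluing ↔
      (Sig.stub_armPairGluing ∧ Sig.stub_boxRestriction) :=
  ⟨fun h => ⟨armPairGluing_of_boxGluing h, boxRestriction_of_boxGluing h⟩,
    fun h => BoxGluing_of h.1 h.2⟩

/-- **The coarse-scale form (r2's `stub_weakGluing`) is crux-implied** — and conversely crux-EQUIVALENT
(readers' W.lean `EreadProbe.boxGluing_iff_weakGluing`, EreadProbe2.lean `boxGluing_of_weakGluing`: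
from the coarse form with `(C, K)` one gets `BoxGluing` with `K' = K + 1`, `C' = 64 K³ C + (2K+1)³`, taking
`n = ⌊m/K⌋` for `m ≥ K` and the `x = 0` term for `m < K`), which is why r2 was not a cut of the crux.  Here the
forward direction: `π_{Kn} ≤ π_n` (`DCT16.real_siteToBoundary_antitone`) and `Λ_{Kn} ⊆ Λ_{(K+1)n}`. -/
theorem coarse_of_boxGluing
    (h : Summit.CriticalPhenomena.PercolationContinuityZ3.Theses.PercHyperscalingGluing.BoxGluing) :
    ∃ C : ℝ, ∃ K : ℕ, 0 < C ∧ 1 ≤ K ∧ ∀ n : ℕ, 1 ≤ n →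
      ((box 3 n).card : ℝ) *
          (bondPercolation (zdGraph 3) (criticalProbI 3)).real (siteToBoundary 3 (K * n)) ^ 2 ≤
        C * ∑ x ∈ box 3 n, (bondPercolation (zdGraph 3) (criticalProbI 3)).real
          (openConnIn ↑(box 3 ((K + 1) * n)) 0 x) := by
  obtain ⟨C, K, hC, hK, h⟩ := h
  refine ⟨C, K, hC, hK, fun n hn => ?_⟩
  set P : Measure (BondConfig (Site 3)) := bondPercolation (zdGraph 3) (criticalProbI 3) with hP
  have hcard : (0 : ℝ) ≤ ((box 3 n).card : ℝ) := Nat.cast_nonneg _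
  have h1 : P.real (siteToBoundary 3 (K * n)) ≤ P.real (siteToBoundary 3 n) :=
    DCT16.real_siteToBoundary_antitone _ (Nat.le_mul_of_pos_left n hK)
  have hBG := mul_sq_le_of_boxGluing (h n hn)
  have hmono := sum_openConnIn_box_mono (Nat.mul_le_mul_right n (Nat.le_succ K)) (box 3 n)
  calc ((box 3 n).card : ℝ) * P.real (siteToBoundary 3 (K * n)) ^ 2
      ≤ ((box 3 n).card : ℝ) * P.real (siteToBoundary 3 n) ^ 2 :=
        mul_le_mul_of_nonneg_left (pow_le_pow_left₀ measureReal_nonneg h1 2) hcard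
    _ ≤ C * ∑ x ∈ box 3 n, P.real (openConnIn ↑(box 3 (K * n)) 0 x) := hBG
    _ ≤ C * ∑ x ∈ box 3 n, P.real (openConnIn ↑(box 3 ((K + 1) * n)) 0 x) :=
        mul_le_mul_of_nonneg_left hmono hC.le

/-- **Both open stubs from X_B** (`CritAnnulusNonCrossing`, stmt-CriticalPhenomena-0846), through the landed
cone edge `Theorems.boxGluing_of_critAnnulusNonCrossing` (p149070): the skeleton is CLOSED MODULO stmt-0846. -/
theorem openStubs_of_critAnnulusNonCrossing
    (hX : Summit.CriticalPhenomena.PercolationContinuityZ3.Theses.PercAnnulusCrossing.CritAnnulusNonCrossing) :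
    Sig.stub_armPairGluing ∧ Sig.stub_boxRestriction :=
  boxGluing_iff_openStubs.1
    (Summit.CriticalPhenomena.PercolationContinuityZ3.Theorems.boxGluing_of_critAnnulusNonCrossing hX)

end Summit.CriticalPhenomena.PercolationContinuityZ3.Cruxes.BoxGluing.Birth
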